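import Literature.NumberTheory.GaloisRepresentations.PadicAlgebraOfLocalField
import Literature.NumberTheory.GaloisRepresentations.InertiaRootsOfUnity
import Mathlib.NumberTheory.Padics.Hensel
import HarnessLib

/-!
# Every ring homomorphism `ℚ_p → K` into a local field is the canonical one

Let `K` be a non-archimedean local field and `f : ℚ_[p] →+* K` ANY ring homomorphism (no
continuity assumed).  This file proves that `f` maps `ℤ_p` into `𝒪_K`
(`valuation_map_padicInt_le_one`), that the residue characteristic of `K` is then `p`
(`valuation_natCast_lt_one_of_ringHom`), and hence (file `PadicAlgebraOfLocalField`,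
`eq_padicRingHom`) that **`f` is the canonical embedding** `padicRingHom K p _`
(`eq_padicRingHom_of_ringHom`; in particular `f` is continuous and any two such maps coincide,
`ringHom_padic_ext`).  So an abstract `ℚ_p`-algebra structure on a local field — as carried by
the datum `PstWeilDeligneData.algebra` and by the bound variable `Algebra ℚ_[p] K` of
`Kisin2007_crystallineDeformationRings` — is automatically the canonical one.

## Proof

Purely multiplicative ("divisible elements have trivial valuation"): a principal unit
`y ∈ 1 + pℤ_p` has `n`-th roots in `ℤ_p` for every `n` prime to `p` (Hensel,
Mathlib `hensels_lemma`), so `|f y| = |f z_n| ^ n` is an `n`-th power in the value group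
`|ϖ| ^ ℤ` of `K` for infinitely many `n`, forcing `|f y| = 1`; a unit `u ∈ ℤ_pˣ` has
`u ^ (p-1) ∈ 1 + pℤ_p` (Fermat), so `|f u| = 1`; and `x = u p^k` gives `|f x| = |p|_K ^ k ≤ 1`.
If `p` were a unit of `𝒪_K` then `f(ℚ_p) ⊆ 𝒪_K` and `ℚ_p` would embed in the finite residue
field. (F. K. Schmidt / folklore: "`ℚ_p` is rigid"; cf. Neukirch, *ANT*, Ch. II §5, and
Serre, *Local Fields*, Ch. II §4–§5.)

No definitions; no named facts.

## References

* [SerreLocalFields1979] J.-P. Serre, *Local Fields*, GTM 67, Ch. II §4 Prop. 8, §5.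
* [NeukirchANT1999] J. Neukirch, *Algebraic Number Theory*, Ch. II (5.2)–(5.3), (4.9) (Hensel).
-/

noncomputable section

open ValuativeRel Field Polynomial
open scoped Pointwise

namespace Literature.NumberTheory.GaloisRepresentations
namespace LocalField

open IsNonarchimedeanLocalField

/-! ### `n`-th roots of principal units in `ℤ_p` -/

section PadicInt

variable {p : ℕ} [Fact p.Prime]

/-- **Principal units of `ℤ_p` are `n`-th powers for `n` prime to `p`** (Hensel's lemma for
`X ^ n - y` at `1`: `|1 - y| < 1 = |n|²`). Neukirch, *ANT*, Ch. II (4.9); Serre, *Local Fields*,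
Ch. II §4. [cite: NeukirchANT1999, Ch. II (4.9)] -/
theorem PadicInt.exists_pow_eq_of_norm_sub_one_lt {n : ℕ} (hn : p.Coprime n) {y : ℤ_[p]}
    (hy : ‖y - 1‖ < 1) : ∃ z : ℤ_[p], z ^ n = y := by
  have hn0 : n ≠ 0 := by
    rintro rfl
    exact (Nat.Prime.one_lt (Fact.out : p.Prime)).ne' (Nat.Coprime.eq_one_of_dvd hn (dvd_zero p))
  set F : Polynomial ℤ_[p] := X ^ n - C y with hF
  have hder : F.derivative.aeval (1 : ℤ_[p]) = (n : ℤ_[p]) := by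
    rw [hF, derivative_sub, derivative_X_pow, derivative_C, sub_zero, map_mul, map_pow, aeval_X,
      one_pow, mul_one, aeval_C, map_natCast]
  have hval : F.aeval (1 : ℤ_[p]) = 1 - y := by
    rw [hF, map_sub, map_pow, aeval_X, aeval_C, one_pow, Algebra.algebraMap_self, RingHom.id_apply]
  have hnorm : ‖F.aeval (1 : ℤ_[p])‖ < ‖F.derivative.aeval (1 : ℤ_[p])‖ ^ 2 := by
    rw [hder, hval, PadicInt.norm_natCast_eq_one_iff.2 hn, one_pow, ← norm_neg, neg_sub]
    exact hy
  obtain ⟨z, hz, -⟩ := hensels_lemma hnorm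
  refine ⟨z, ?_⟩
  rw [hF, map_sub, map_pow, aeval_X, aeval_C, Algebra.algebraMap_self, RingHom.id_apply,
    sub_eq_zero] at hz
  exact hz

/-- **Fermat in `ℤ_p`**: a unit `u` of `ℤ_p` has `u ^ (p - 1) ≡ 1 (mod p)`. [folklore] -/
theorem PadicInt.norm_unit_pow_sub_one_sub_one_lt (u : ℤ_[p]ˣ) :
    ‖(u : ℤ_[p]) ^ (p - 1) - 1‖ < 1 := by
  rw [← PadicInt.mem_nonunits, ← IsLocalRing.mem_maximalIdeal, ← PadicInt.ker_toZMod,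
    RingHom.mem_ker, map_sub, map_pow, map_one, sub_eq_zero]
  have hu : IsUnit (PadicInt.toZMod (u : ℤ_[p])) := u.isUnit.map _
  have hne : PadicInt.toZMod (u : ℤ_[p]) ≠ 0 := hu.ne_zero
  exact ZMod.pow_card_sub_one_eq_one hne

end PadicInt

/-! ### Ring homomorphisms `ℚ_p → K` -/

section RingHom

variable {K : Type*} [Field K] [ValuativeRel K] [TopologicalSpace K] [IsNonarchimedeanLocalField K]
  {p : ℕ} [Fact p.Prime] (f : ℚ_[p] →+* K)

/-- The absolute value `|f x|` of the image of `x ∈ ℚ_p`, measured in `K̄` (`algNorm K`).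
(Auxiliary abbreviation.) [folklore] -/
abbrev normOfRingHom (x : ℚ_[p]) : ℝ :=
  algNorm K (algebraMap K (AlgebraicClosure K) (f x))

/-- `|f (x y)| = |f x| |f y|`. [folklore] -/
theorem normOfRingHom_mul (x y : ℚ_[p]) :
    normOfRingHom f (x * y) = normOfRingHom f x * normOfRingHom f y := by
  simp only [normOfRingHom, map_mul, algNorm_mul]

/-- `|f (x ^ n)| = |f x| ^ n`. [folklore] -/
theorem normOfRingHom_pow (x : ℚ_[p]) (n : ℕ) :
    normOfRingHom f (x ^ n) = normOfRingHom f x ^ n := by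
  simp only [normOfRingHom, map_pow, algNorm_pow]

/-- `|f x| = 0 ↔ x = 0` (`f` is injective). [folklore] -/
theorem normOfRingHom_eq_zero_iff {x : ℚ_[p]} : normOfRingHom f x = 0 ↔ x = 0 := by
  rw [normOfRingHom, algNorm_eq_zero_iff, map_eq_zero, map_eq_zero_iff f f.injective]

/-- `|f x| ∈ |ϖ| ^ ℤ` for `x ≠ 0`. [folklore] -/
theorem exists_normOfRingHom_eq_zpow {ϖ : 𝒪[K]} (hϖ : Irreducible ϖ) {x : ℚ_[p]} (hx : x ≠ 0) :
    ∃ n : ℤ, normOfRingHom f x = algNorm K (algebraMap 𝒪[K] (AlgebraicClosure K) ϖ) ^ n :=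
  exists_algNorm_algebraMap_eq_zpow hϖ ((map_ne_zero_iff f f.injective).2 hx)

/-- **Principal units of `ℤ_p` have absolute value `1` under any `f : ℚ_p → K`**: they are
`n`-th powers for all `n` prime to `p`, and the value group of `K` is `|ϖ| ^ ℤ`.
[cite: SerreLocalFields1979, Ch. II §5] -/
theorem normOfRingHom_eq_one_of_norm_sub_one_lt {y : ℤ_[p]} (hy : ‖y - 1‖ < 1) :
    normOfRingHom f y = 1 := by
  obtain ⟨ϖ, hϖ⟩ := IsDiscreteValuationRing.exists_irreducible 𝒪[K]
  set c := algNorm K (algebraMap 𝒪[K] (AlgebraicClosure K) ϖ) with hc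
  have hc0 : 0 < c := algNorm_uniformizer_pos hϖ
  have hc1 : c < 1 := algNorm_uniformizer_lt_one hϖ
  have hy0 : (y : ℚ_[p]) ≠ 0 := by
    intro h
    rw [PadicInt.coe_eq_zero] at h
    rw [h, zero_sub, norm_neg, norm_one] at hy
    exact lt_irrefl _ hy
  obtain ⟨a, ha⟩ := exists_normOfRingHom_eq_zpow f hϖ hy0
  -- `n = |a| p + 1` is prime to `p` and exceeds `|a|`
  set n : ℕ := a.natAbs * p + 1 with hn
  have hcop : p.Coprime n := by
    rw [hn, Nat.coprime_comm, Nat.coprime_mul_right_add_left]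
    exact Nat.coprime_one_left p
  obtain ⟨z, hz⟩ := PadicInt.exists_pow_eq_of_norm_sub_one_lt hcop hy
  have hn0 : n ≠ 0 := by rw [hn]; omega
  have hz0 : (z : ℚ_[p]) ≠ 0 := by
    intro h
    rw [PadicInt.coe_eq_zero] at h
    rw [h, zero_pow hn0] at hz
    exact hy0 (by rw [← hz, PadicInt.coe_zero])
  obtain ⟨b, hb⟩ := exists_normOfRingHom_eq_zpow f hϖ hz0
  have hab : a = n * b := by
    have h1 : normOfRingHom f y = normOfRingHom f z ^ n := by
      rw [← normOfRingHom_pow, ← PadicInt.coe_pow, hz]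
    rw [ha, hb, ← zpow_natCast, ← zpow_mul, mul_comm] at h1
    exact zpow_right_injective₀ hc0 hc1.ne h1
  have ha0 : a = 0 := by
    refine Int.eq_zero_of_dvd_of_natAbs_lt_natAbs ⟨b, hab⟩ ?_
    rw [hn, Int.natAbs_natCast]
    exact Nat.lt_succ_of_le (Nat.le_mul_of_pos_right _ (Fact.out : p.Prime).pos)
  rw [ha, ha0, zpow_zero]

/-- **Units of `ℤ_p` have absolute value `1` under any `f : ℚ_p → K`** (Fermat:
`u ^ (p-1)` is a principal unit). [cite: SerreLocalFields1979, Ch. II §5] -/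
theorem normOfRingHom_unit (u : ℤ_[p]ˣ) : normOfRingHom f (u : ℤ_[p]) = 1 := by
  have h1 := normOfRingHom_eq_one_of_norm_sub_one_lt f (PadicInt.norm_unit_pow_sub_one_sub_one_lt u)
  rw [PadicInt.coe_pow, normOfRingHom_pow] at h1
  have hp : p - 1 ≠ 0 := by have := (Fact.out : p.Prime).two_le; omega
  exact (pow_eq_one_iff_of_nonneg (algNorm_nonneg _) hp).1 h1

/-- `|f p| ≤ 1` (`p ∈ ℤ ⊆ 𝒪_K`). [folklore] -/
theorem normOfRingHom_natCast_le_one : normOfRingHom f (p : ℤ_[p]) ≤ 1 := by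
  rw [normOfRingHom, PadicInt.coe_natCast, map_natCast, ← map_natCast (algebraMap 𝒪[K] K) p,
    ← IsScalarTower.algebraMap_apply]
  exact algNorm_algebraMap_integer _

/-- **Any ring homomorphism `ℚ_p → K` maps `ℤ_p` into `𝒪_K`.**
[cite: SerreLocalFields1979, Ch. II §5] -/
theorem valuation_map_padicInt_le_one (x : ℤ_[p]) : valuation K (f x) ≤ 1 := by
  change f x ∈ 𝒪[K]
  rw [← algNorm_algebraMap_le_one_iff]
  change normOfRingHom f x ≤ 1
  by_cases hx : x = 0
  · rw [hx, PadicInt.coe_zero, normOfRingHom, map_zero, map_zero, algNorm_zero]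
    exact zero_le_one
  rw [PadicInt.unitCoeff_spec hx, PadicInt.coe_mul, PadicInt.coe_pow, normOfRingHom_mul,
    normOfRingHom_pow, normOfRingHom_unit, one_mul]
  exact pow_le_one₀ (algNorm_nonneg _) (normOfRingHom_natCast_le_one f)

/-- **The residue characteristic of `K` is `p`** as soon as there is a ring homomorphism
`ℚ_p → K`: otherwise `p` is a unit of `𝒪_K`, `f(ℚ_p) ⊆ 𝒪_K`, and `ℚ_p` embeds in the finite
residue field. [cite: SerreLocalFields1979, Ch. II §5] -/
theorem valuation_natCast_lt_one_of_ringHom (f : ℚ_[p] →+* K) : valuation K (p : K) < 1 := by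
  by_contra hlt
  have hle : valuation K (p : K) ≤ 1 := by
    have := valuation_map_padicInt_le_one f (p : ℤ_[p])
    rwa [PadicInt.coe_natCast, map_natCast] at this
  have heq : valuation K (p : K) = 1 := le_antisymm hle (not_lt.1 hlt)
  -- `p` is a unit of `𝒪_K`, so `p⁻¹ ∈ 𝒪_K` and `f` lands in `𝒪_K`
  have hunit : IsUnit ((p : ℕ) : 𝒪[K]) := by
    rw [Valuation.Integers.isUnit_iff_valuation_eq_one (Valuation.integer.integers (valuation K))]
    exact heq
  obtain ⟨u, hu⟩ := hunit
  have hpinv : ((p : K))⁻¹ ∈ 𝒪[K] := by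
    have h1 : ((u⁻¹ : 𝒪[K]ˣ) : 𝒪[K]) * (p : 𝒪[K]) = 1 := by rw [← hu, Units.inv_mul]
    have h2 : (((u⁻¹ : 𝒪[K]ˣ) : 𝒪[K]) : K) * (p : K) = 1 := by
      have := congrArg (fun z : 𝒪[K] => (z : K)) h1
      simpa using this
    rw [← eq_inv_of_mul_eq_one_left h2]
    exact SetLike.coe_mem _
  have hp0 : (p : ℚ_[p]) ≠ 0 := Nat.cast_ne_zero.2 (Fact.out : p.Prime).ne_zero
  have hmem : ∀ x : ℚ_[p], f x ∈ 𝒪[K] := by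
    intro x
    by_cases hx : x = 0
    · rw [hx, map_zero]; exact zero_mem _
    -- `x = y * p ^ (-k)` with `y ∈ ℤ_p`
    obtain ⟨k, hk⟩ : ∃ k : ℕ, ‖x * (p : ℚ_[p]) ^ k‖ ≤ 1 := by
      obtain ⟨k, hk⟩ := exists_pow_lt_of_lt_one (show 0 < ‖x‖⁻¹ from inv_pos.2 (norm_pos_iff.2 hx))
        (show ‖(p : ℚ_[p])‖ < 1 from by
          rw [Padic.norm_p]; exact inv_lt_one_of_one_lt₀ (by exact_mod_cast (Fact.out : p.Prime).one_lt))
      refine ⟨k, ?_⟩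
      rw [norm_mul, norm_pow]
      have := mul_lt_mul_of_pos_left hk (norm_pos_iff.2 hx)
      rw [mul_inv_cancel₀ (norm_ne_zero_iff.2 hx)] at this
      exact this.le
    set y : ℤ_[p] := ⟨x * (p : ℚ_[p]) ^ k, hk⟩ with hy
    have hx' : x = (y : ℚ_[p]) * ((p : ℚ_[p]) ^ k)⁻¹ := by
      rw [hy]
      change x = x * (p : ℚ_[p]) ^ k * ((p : ℚ_[p]) ^ k)⁻¹
      rw [mul_inv_cancel_right₀ (pow_ne_zero _ hp0)]
    rw [hx', map_mul, map_inv₀, map_pow, map_natCast, ← inv_pow]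
    exact mul_mem (valuation_map_padicInt_le_one f y) (pow_mem hpinv k)
  -- the induced ring map `ℚ_p → 𝓀[K]` is injective, absurd
  let g : ℚ_[p] →+* 𝓀[K] :=
    (IsLocalRing.residue 𝒪[K]).comp (f.codRestrict 𝒪[K] hmem)
  haveI : Infinite ℚ_[p] := Infinite.of_injective _ Nat.cast_injective
  haveI : Finite ℚ_[p] := Finite.of_injective g g.injective
  exact not_finite ℚ_[p]

/-- **Every ring homomorphism `ℚ_p → K` is the canonical embedding** `padicRingHom`
(file `PadicAlgebraOfLocalField`); in particular it is continuous.
[cite: SerreLocalFields1979, Ch. II §5] -/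
theorem eq_padicRingHom_of_ringHom [CharZero K] :
    f = padicRingHom K p (valuation_natCast_lt_one_of_ringHom f) :=
  eq_padicRingHom K p _ f (valuation_map_padicInt_le_one f)

/-- Any ring homomorphism `ℚ_p → K` is continuous. [cite: SerreLocalFields1979, Ch. II §5] -/
theorem continuous_of_ringHom_padic [CharZero K] : Continuous f := by
  rw [eq_padicRingHom_of_ringHom f]
  exact continuous_padicRingHom K p _

/-- **Rigidity**: any two ring homomorphisms `ℚ_p → K` coincide. [cite: SerreLocalFields1979, Ch. II §5] -/
theorem ringHom_padic_ext [CharZero K] (f g : ℚ_[p] →+* K) : f = g := by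
  rw [eq_padicRingHom_of_ringHom f, eq_padicRingHom_of_ringHom g]

/-- The `ℚ_p`-algebra structures on a local field form a subsingleton. [folklore] -/
theorem algebra_padic_ext [CharZero K] (a b : Algebra ℚ_[p] K) : a = b :=
  Algebra.algebra_ext a b fun x => RingHom.congr_fun (ringHom_padic_ext (a.algebraMap) (b.algebraMap)) x

/-- For an `ℚ_p`-algebra structure on a local field, `ℤ_p` is mapped into `𝒪_K`. [folklore] -/
theorem valuation_algebraMap_padicInt_le_one [Algebra ℚ_[p] K] (x : ℤ_[p]) :
    valuation K (algebraMap ℚ_[p] K x) ≤ 1 :=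
  valuation_map_padicInt_le_one (algebraMap ℚ_[p] K) x

/-- For an `ℚ_p`-algebra structure on a local field, the residue characteristic is `p`:
`|p|_K < 1`. [folklore] -/
theorem valuation_natCast_lt_one_of_algebra [Algebra ℚ_[p] K] : valuation K (p : K) < 1 :=
  valuation_natCast_lt_one_of_ringHom (algebraMap ℚ_[p] K)

end RingHom

end LocalField
end Literature.NumberTheory.GaloisRepresentations

end
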